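import Summits.QuantumAdvantage.QuantumAdvantage.Theorems.SosSandwichPseudoBoundedAAClassicalCornerQueryOSSS
import HarnessLib

/-!
# Crux `PseudoBoundedAA` (stmt-QuantumAdvantage-15237, route SosSandwich) — the classical corner `R_T`:
# QUERY CONCENTRATION — `4·Var[p] ≤ Σⱼ δ̄ⱼ²` and `Infⱼ[p] ≤ δ̄ⱼ` for every probability mixture of decision trees

Support file (`--supports stmt-QuantumAdvantage-15237`) for the classical corner `R_T ⊆ K_T` of the crux PB-AA
(acceptance probabilities `p = Σ_k w_k·[t_k accepts]` of randomized classical query algorithms; `δ̄ⱼ = Σ_k w_k·Pr_x[j ∈ t_k.queries x]`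
the mixture's query probabilities, `Σⱼ δ̄ⱼ ≤ D̄ = Σ_k w_k depth(t_k)`).

The tree's laws on `R_T` bound the variance by query probabilities TIMES influences (`Var ≤ ¼ Σⱼ δ̄ⱼ √Infⱼ`,
`ClassicalCornerQueryOSSS`; `16 Var² ≤ Σⱼ E_x[δⱼ(x)·(Δⱼp)²]`, `ClassicalCornerPathSensitivity`).  This file records the two
DOMINATIONS that hold between the two currencies themselves, and the variance bound in query probabilities ALONE that follows:

* `abs_update_sub_le_queryWeight` — pointwise, `|p(x^{j→1}) − p(x^{j→0})| ≤ δⱼ(x) := Σ_k w_k·[j ∈ t_k.queries x]`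
  (a tree that does not read `j` on `x` has the same output on `x^{j→0}` and `x^{j→1}`);
* `influence_le_queryProb` — hence **`Infⱼ[p] ≤ δ̄ⱼ`** when `Σ_k w_k ≤ 1` (the randomized form of `Infⱼ[f] ≤ δⱼ(t)` for a
  single tree);
* **`four_boolVariance_le_sum_queryProb_sq`** — `4·Var[p] ≤ Σⱼ δ̄ⱼ²` for every nonnegative mixture: the two-function OSSS
  inequality with query probabilities (`ClassicalCornerQueryOSSS.osss_queries`) applied with `g := p`, whose `L¹` increments are
  bounded by the query counts themselves (no Cauchy–Schwarz, no influences).  EQUALITY for every uniform mixture of distinct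
  dictators (`N` dictators: `Var = 1/(4N)`, `δ̄ⱼ = 1/N`), in particular for a single dictator;
* `four_boolVariance_le_mul_sum_queryProb`, **`exists_queryProb_ge`** — consequently some variable is READ with probability
  `δ̄ⱼ ≥ 4·Var[p] / Σᵢ δ̄ᵢ ≥ 4·Var[p]/D̄`: a randomized query algorithm whose acceptance probability has variance `ε` and which
  makes `D̄` queries on average concentrates probability `≥ 4ε/D̄` of reading on ONE variable — the query-probability analogue,
  with the sharp exponent pair `(1,1)`, of the influence statement PB-AA asks for (`(2,2)` proved / `(2,1)` conjectured on `R_T`).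

Relation to the cell's open `L²`-OSSS question (`16 Var² ≤ C₀ Σⱼ δ̄ⱼ Infⱼ`, bracket `[8/7, Σⱼ δ̄ⱼ]`): the dominations give
`Σⱼ δ̄ⱼ Infⱼ ≤ Σⱼ δ̄ⱼ²` and `16 Var² ≤ (Σⱼ δ̄ⱼ²)²`, i.e. both sides of the conjectured law live below the same query-profile
quantity; they do not decide `C₀`.

Honest label: elementary dominations on a corner of an open conjecture (OSSS with `g := p` and the trivial `L¹` bound); no
registered stub, crux or summit is closed.  Sources: R. O'Donnell, M. Saks, O. Schramm, R. Servedio, *Every decision tree has an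
influential variable*, FOCS 2005, Thm 3.2 (two-function form); R. O'Donnell, *Analysis of Boolean Functions* (2014) §8.6;
H. Buhrman, R. de Wolf, *Complexity measures and decision tree complexity*, TCS 288 (2002) §2.1; S. Aaronson, A. Ambainis,
arXiv:0911.0996, Conj. 6 / Thm 8 and the remark following it.
-/

set_option linter.dupNamespace false

noncomputable section

namespace Summit.QuantumAdvantage.QuantumAdvantage.Theorems.SosSandwich

open Finset Function
open Literature.Computability.Complexity Literature.Computability.QuantumComplexity

namespace ClassicalCornerQueryConcentration

variable {N : ℕ}

/-! ### Pointwise domination of increments by the query indicator -/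

/-- A single tree: `|[t accepts x^{j→1}] − [t accepts x^{j→0}]| ≤ [j ∈ t.queries x]` — if `t` does not read `j` on `x`
its output does not depend on `x j`. [cite: Wolf2002, §2.1] -/
theorem abs_output_update_sub_le (t : DecisionTree N) (x : Fin N → Bool) (j : Fin N) :
    |(if t.eval (update x j true) = true then (1 : ℝ) else 0) -
        (if t.eval (update x j false) = true then (1 : ℝ) else 0)|
      ≤ if j ∈ t.queries x then (1 : ℝ) else 0 := by
  by_cases hj : j ∈ t.queries x
  · rw [if_pos hj]
    split_ifs <;> norm_num
  · rw [if_neg hj, DecisionTree.eval_update_of_not_mem_queries t x hj true,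
      DecisionTree.eval_update_of_not_mem_queries t x hj false, sub_self, abs_zero]

/-- **Increments of a mixture are dominated by its query weight**, pointwise: if `p = Σ_{k∈s} w_k·[t_k accepts]` on the
cube (`w_k ≥ 0`) then `|p(x^{j→1}) − p(x^{j→0})| ≤ δⱼ(x) := Σ_{k∈s} w_k·[j ∈ t_k.queries x]`. [cite: Wolf2002, §2.1] -/
theorem abs_update_sub_le_queryWeight {ι : Type*} (s : Finset ι) (w : ι → ℝ) (hw : ∀ k ∈ s, 0 ≤ w k)
    (t : ι → DecisionTree N) (p : MvPolynomial (Fin N) ℝ)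
    (hp : ∀ x, evalBool p x = ∑ k ∈ s, w k * (if (t k).eval x = true then (1 : ℝ) else 0))
    (x : Fin N → Bool) (j : Fin N) :
    |evalBool p (update x j true) - evalBool p (update x j false)|
      ≤ ∑ k ∈ s, w k * (if j ∈ (t k).queries x then (1 : ℝ) else 0) := by
  rw [hp, hp, ← Finset.sum_sub_distrib]
  refine (Finset.abs_sum_le_sum_abs _ _).trans (Finset.sum_le_sum fun k hk => ?_)
  rw [← mul_sub, abs_mul, abs_of_nonneg (hw k hk)]
  exact mul_le_mul_of_nonneg_left (abs_output_update_sub_le (t k) x j) (hw k hk)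

/-- Summed over the cube: `Σₓ |p(x^{j→1}) − p(x^{j→0})| ≤ Σ_k w_k·#{x : j ∈ t_k.queries x}` (`= 2^N·δ̄ⱼ`).
[cite: Wolf2002, §2.1] -/
theorem sum_abs_update_sub_le_queryCount {ι : Type*} (s : Finset ι) (w : ι → ℝ) (hw : ∀ k ∈ s, 0 ≤ w k)
    (t : ι → DecisionTree N) (p : MvPolynomial (Fin N) ℝ)
    (hp : ∀ x, evalBool p x = ∑ k ∈ s, w k * (if (t k).eval x = true then (1 : ℝ) else 0)) (j : Fin N) :
    ∑ x, |evalBool p (update x j true) - evalBool p (update x j false)|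
      ≤ ∑ k ∈ s, w k * ((Finset.univ.filter fun x : Fin N → Bool => j ∈ (t k).queries x).card : ℝ) := by
  classical
  calc ∑ x, |evalBool p (update x j true) - evalBool p (update x j false)|
      ≤ ∑ x, ∑ k ∈ s, w k * (if j ∈ (t k).queries x then (1 : ℝ) else 0) :=
        Finset.sum_le_sum fun x _ => abs_update_sub_le_queryWeight s w hw t p hp x j
    _ = ∑ k ∈ s, ∑ x, w k * (if j ∈ (t k).queries x then (1 : ℝ) else 0) := Finset.sum_comm
    _ = ∑ k ∈ s, w k * ((Finset.univ.filter fun x : Fin N → Bool => j ∈ (t k).queries x).card : ℝ) := by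
        refine Finset.sum_congr rfl fun k _ => ?_
        rw [← Finset.mul_sum, Finset.sum_boole]

/-! ### Influences are dominated by query probabilities -/

/-- **`Infⱼ[p] ≤ δ̄ⱼ`** for a probability sub-mixture (`w ≥ 0`, `Σ w ≤ 1`): the `L²` influence of `j` on the acceptance
probability is at most the probability that `j` is read (`(Δⱼp)² ≤ |Δⱼp| ≤ δⱼ(x)` pointwise, then average).
[cite: OdonnellEtAl2005, Thm 3.2 (setting)] [cite: Wolf2002, §2.1] -/
theorem influence_le_queryProb {ι : Type*} (s : Finset ι) (w : ι → ℝ) (hw : ∀ k ∈ s, 0 ≤ w k)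
    (hw1 : ∑ k ∈ s, w k ≤ 1) (t : ι → DecisionTree N) (p : MvPolynomial (Fin N) ℝ)
    (hp : ∀ x, evalBool p x = ∑ k ∈ s, w k * (if (t k).eval x = true then (1 : ℝ) else 0)) (j : Fin N) :
    influence j p ≤ ∑ k ∈ s, w k *
      (((Finset.univ.filter fun x : Fin N → Bool => j ∈ (t k).queries x).card : ℝ) / (2 : ℝ) ^ N) := by
  classical
  have h2N : (0 : ℝ) < (2 : ℝ) ^ N := by positivity
  -- pointwise: `(p(x) − p(xʲ))² ≤ δⱼ(x)`
  have hpt : ∀ x, (evalBool p x - evalBool p (flipBit j x)) ^ 2 ≤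
      ∑ k ∈ s, w k * (if j ∈ (t k).queries x then (1 : ℝ) else 0) := by
    intro x
    have hδ := abs_update_sub_le_queryWeight s w hw t p hp x j
    rw [ClassicalCorner.abs_update_sub_eq (evalBool p) j x] at hδ
    have hδ1 : ∑ k ∈ s, w k * (if j ∈ (t k).queries x then (1 : ℝ) else 0) ≤ 1 :=
      (Finset.sum_le_sum fun k hk => by
        have := hw k hk
        split_ifs <;> nlinarith).trans (by simpa using hw1)
    have ha : |evalBool p x - evalBool p (flipBit j x)| ≤ 1 := hδ.trans hδ1
    have h0 : 0 ≤ |evalBool p x - evalBool p (flipBit j x)| := abs_nonneg _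
    calc (evalBool p x - evalBool p (flipBit j x)) ^ 2 = |evalBool p x - evalBool p (flipBit j x)| ^ 2 := by
          rw [sq_abs]
      _ ≤ |evalBool p x - evalBool p (flipBit j x)| := by nlinarith
      _ ≤ _ := hδ
  -- average
  unfold influence boolAvg
  rw [div_le_iff₀ h2N]
  calc ∑ x, (evalBool p x - evalBool p (flipBit j x)) ^ 2
      ≤ ∑ x, ∑ k ∈ s, w k * (if j ∈ (t k).queries x then (1 : ℝ) else 0) := Finset.sum_le_sum fun x _ => hpt x
    _ = ∑ k ∈ s, ∑ x, w k * (if j ∈ (t k).queries x then (1 : ℝ) else 0) := Finset.sum_comm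
    _ = ∑ k ∈ s, w k * ((Finset.univ.filter fun x : Fin N → Bool => j ∈ (t k).queries x).card : ℝ) := by
        refine Finset.sum_congr rfl fun k _ => ?_
        rw [← Finset.mul_sum, Finset.sum_boole]
    _ = (∑ k ∈ s, w k *
          (((Finset.univ.filter fun x : Fin N → Bool => j ∈ (t k).queries x).card : ℝ) / (2 : ℝ) ^ N)) * (2 : ℝ) ^ N := by
        rw [Finset.sum_mul]
        refine Finset.sum_congr rfl fun k _ => ?_
        field_simp

/-! ### The variance in query probabilities alone: `4·Var[p] ≤ Σⱼ δ̄ⱼ²` -/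

/-- **Query-concentration law.** If the real polynomial `p` is on the cube a nonnegative mixture `Σ_{k∈s} w_k·[t_k accepts]`
of decision trees, then

  `4 · Var[p] ≤ Σⱼ δ̄ⱼ²`,  `δ̄ⱼ = Σ_k w_k · Pr_x[j ∈ t_k.queries x]`.

Proof: `Var[p] = Σ_k w_k Cov([t_k accepts], p)`; each covariance is at most `¼ Σⱼ δⱼ(t_k)·E|p(x^{j→1}) − p(x^{j→0})|` (two-function
OSSS with query probabilities), and `E|p(x^{j→1}) − p(x^{j→0})| ≤ δ̄ⱼ` (`sum_abs_update_sub_le_queryCount`).  Equality for the uniform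
mixture of `N` distinct dictators (`Var = 1/(4N)`, `δ̄ⱼ = 1/N`). [cite: OdonnellEtAl2005, Thm 3.2] [cite: ODonnell2014, §8.6] -/
theorem four_boolVariance_le_sum_queryProb_sq {ι : Type*} (s : Finset ι) (w : ι → ℝ) (hw : ∀ k ∈ s, 0 ≤ w k)
    (t : ι → DecisionTree N) (p : MvPolynomial (Fin N) ℝ)
    (hp : ∀ x, evalBool p x = ∑ k ∈ s, w k * (if (t k).eval x = true then (1 : ℝ) else 0)) :
    4 * boolVariance p ≤ ∑ j, (∑ k ∈ s, w k *
        (((Finset.univ.filter fun x : Fin N → Bool => j ∈ (t k).queries x).card : ℝ) / (2 : ℝ) ^ N)) ^ 2 := by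
  classical
  have h2N : (0 : ℝ) < (2 : ℝ) ^ N := by positivity
  set F : ι → (Fin N → Bool) → ℝ := fun k x => if (t k).eval x = true then (1 : ℝ) else 0 with hF
  set g := evalBool p with hgdef
  set cnt : ι → Fin N → ℝ := fun k j =>
    ((Finset.univ.filter fun x : Fin N → Bool => j ∈ (t k).queries x).card : ℝ) with hcnt
  set δ : Fin N → ℝ := fun j => ∑ k ∈ s, w k * (cnt k j / (2 : ℝ) ^ N) with hδ
  set M : Fin N → ℝ := fun j => ∑ k ∈ s, w k * cnt k j with hMdef
  change 4 * boolVariance p ≤ ∑ j, δ j ^ 2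
  have hM : ∀ j, 0 ≤ M j := fun j => Finset.sum_nonneg fun k hk => mul_nonneg (hw k hk) (by positivity)
  have hg : ∀ j : Fin N, ∑ x, |g (update x j true) - g (update x j false)| ≤ M j := fun j =>
    sum_abs_update_sub_le_queryCount s w hw t p hp j
  have hMδ : ∀ j, M j = (2 : ℝ) ^ N * δ j := by
    intro j
    simp only [hMdef, hδ]
    rw [Finset.mul_sum]
    refine Finset.sum_congr rfl fun k _ => ?_
    field_simp
  -- linearity of the covariance in the first argument
  have hFk : ∀ x, ∑ k ∈ s, w k * F k x = g x := fun x => by rw [hp x]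
  have hPg : ∑ x, g x * g x = ∑ k ∈ s, w k * ∑ x, F k x * g x := by
    calc ∑ x, g x * g x = ∑ x, ∑ k ∈ s, w k * (F k x * g x) := by
          refine Finset.sum_congr rfl fun x _ => ?_
          rw [show g x * g x = (∑ k ∈ s, w k * F k x) * g x by rw [hFk x], Finset.sum_mul]
          exact Finset.sum_congr rfl fun k _ => by ring
      _ = ∑ k ∈ s, ∑ x, w k * (F k x * g x) := Finset.sum_comm
      _ = ∑ k ∈ s, w k * ∑ x, F k x * g x := Finset.sum_congr rfl fun k _ => by rw [Finset.mul_sum]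
  have hPs : ∑ x, g x = ∑ k ∈ s, w k * ∑ x, F k x := by
    calc ∑ x, g x = ∑ x, ∑ k ∈ s, w k * F k x := Finset.sum_congr rfl fun x _ => (hFk x).symm
      _ = ∑ k ∈ s, ∑ x, w k * F k x := Finset.sum_comm
      _ = ∑ k ∈ s, w k * ∑ x, F k x := Finset.sum_congr rfl fun k _ => by rw [Finset.mul_sum]
  have hlin : (2 : ℝ) ^ N * (∑ x, g x * g x) - (∑ x, g x) * (∑ x, g x)
      = ∑ k ∈ s, w k * ((2 : ℝ) ^ N * (∑ x, F k x * g x) - (∑ x, F k x) * (∑ x, g x)) := by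
    rw [hPg, show (∑ x, g x) * (∑ x, g x) = (∑ k ∈ s, w k * ∑ x, F k x) * (∑ x, g x) by rw [← hPs],
      Finset.mul_sum, Finset.sum_mul, ← Finset.sum_sub_distrib]
    exact Finset.sum_congr rfl fun k _ => by ring
  have hvar := BooleanCorner.sum_sq_sub_sq_sum_eq p
  rw [← hgdef] at hvar
  -- `4^N Var ≤ Σ_k w_k (Σ_j cnt_{kj} M_j) / 4 = (Σ_j M_j²) / 4`
  have hbound : (2 : ℝ) ^ N * ((2 : ℝ) ^ N * boolVariance p) ≤
      ∑ k ∈ s, w k * ((∑ j, cnt k j * M j) / 4) := by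
    rw [← hvar, hlin]
    exact Finset.sum_le_sum fun k hk =>
      mul_le_mul_of_nonneg_left (ClassicalCornerQueryOSSS.osss_queries (t k) (F k) g M (fun x => rfl) hM hg) (hw k hk)
  have hre : ∑ k ∈ s, w k * ((∑ j, cnt k j * M j) / 4) = (∑ j, M j * M j) / 4 := by
    calc ∑ k ∈ s, w k * ((∑ j, cnt k j * M j) / 4) = ∑ k ∈ s, (∑ j, w k * cnt k j * M j) / 4 := by
          refine Finset.sum_congr rfl fun k _ => ?_
          rw [← mul_div_assoc, Finset.mul_sum]
          congr 1
          exact Finset.sum_congr rfl fun j _ => by ring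
      _ = (∑ k ∈ s, ∑ j, w k * cnt k j * M j) / 4 := by rw [Finset.sum_div]
      _ = (∑ j, ∑ k ∈ s, w k * cnt k j * M j) / 4 := by rw [Finset.sum_comm]
      _ = (∑ j, M j * M j) / 4 := by
          congr 1
          refine Finset.sum_congr rfl fun j _ => ?_
          rw [hMdef, Finset.sum_mul]
  rw [hre] at hbound
  have hsq : ∑ j, M j * M j = (2 : ℝ) ^ N * ((2 : ℝ) ^ N * ∑ j, δ j ^ 2) := by
    rw [Finset.mul_sum, Finset.mul_sum]
    refine Finset.sum_congr rfl fun j _ => ?_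
    rw [hMδ j]
    ring
  rw [hsq] at hbound
  have h4 : (2 : ℝ) ^ N * ((2 : ℝ) ^ N * (4 * boolVariance p)) ≤ (2 : ℝ) ^ N * ((2 : ℝ) ^ N * ∑ j, δ j ^ 2) := by
    nlinarith [hbound]
  exact le_of_mul_le_mul_left (le_of_mul_le_mul_left h4 h2N) h2N

/-- **Some variable is read often**, bound form: if every query probability is `≤ τ` then `4·Var[p] ≤ τ·Σⱼ δ̄ⱼ`
(`Σⱼ δ̄ⱼ²  ≤ τ Σⱼ δ̄ⱼ`; and `Σⱼ δ̄ⱼ ≤ D̄`, `ClassicalCornerQueryOSSS.sum_queryProb_le_avgDepth`). [cite: OdonnellEtAl2005, Thm 3.2] -/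
theorem four_boolVariance_le_mul_sum_queryProb {ι : Type*} (s : Finset ι) (w : ι → ℝ) (hw : ∀ k ∈ s, 0 ≤ w k)
    (t : ι → DecisionTree N) (p : MvPolynomial (Fin N) ℝ)
    (hp : ∀ x, evalBool p x = ∑ k ∈ s, w k * (if (t k).eval x = true then (1 : ℝ) else 0)) {τ : ℝ}
    (hτ : ∀ j : Fin N, ∑ k ∈ s, w k *
      (((Finset.univ.filter fun x : Fin N → Bool => j ∈ (t k).queries x).card : ℝ) / (2 : ℝ) ^ N) ≤ τ) :
    4 * boolVariance p ≤ τ * ∑ j, ∑ k ∈ s, w k *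
        (((Finset.univ.filter fun x : Fin N → Bool => j ∈ (t k).queries x).card : ℝ) / (2 : ℝ) ^ N) := by
  classical
  set δ : Fin N → ℝ := fun j => ∑ k ∈ s, w k *
    (((Finset.univ.filter fun x : Fin N → Bool => j ∈ (t k).queries x).card : ℝ) / (2 : ℝ) ^ N) with hδ
  have hδ0 : ∀ j, 0 ≤ δ j := fun j => Finset.sum_nonneg fun k hk => mul_nonneg (hw k hk) (by positivity)
  have hmain := four_boolVariance_le_sum_queryProb_sq s w hw t p hp
  change 4 * boolVariance p ≤ ∑ j, δ j ^ 2 at hmain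
  change 4 * boolVariance p ≤ τ * ∑ j, δ j
  refine hmain.trans ?_
  rw [Finset.mul_sum]
  exact Finset.sum_le_sum fun j _ => by
    rw [sq]
    exact mul_le_mul_of_nonneg_right (hτ j) (hδ0 j)

/-- **Every randomized query algorithm with variance reads some variable often**: for a nonnegative mixture of decision trees
on `N ≥ 1` bits there is a variable `j` with `4·Var[p] ≤ (Σᵢ δ̄ᵢ)·δ̄ⱼ`, i.e. `δ̄ⱼ ≥ 4·Var[p]/Σᵢ δ̄ᵢ ≥ 4·Var[p]/D̄` — the
query-probability analogue (sharp exponents `(1,1)`, equality on uniform dictator mixtures) of the influence lower bound the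
crux asks for. [cite: OdonnellEtAl2005, Thm 3.2] [cite: AaronsonAmbainis2014, Conj. 6] -/
theorem exists_queryProb_ge {ι : Type*} (hN : 0 < N) (s : Finset ι) (w : ι → ℝ) (hw : ∀ k ∈ s, 0 ≤ w k)
    (t : ι → DecisionTree N) (p : MvPolynomial (Fin N) ℝ)
    (hp : ∀ x, evalBool p x = ∑ k ∈ s, w k * (if (t k).eval x = true then (1 : ℝ) else 0)) :
    ∃ j : Fin N, 4 * boolVariance p ≤ (∑ i, ∑ k ∈ s, w k *
        (((Finset.univ.filter fun x : Fin N → Bool => i ∈ (t k).queries x).card : ℝ) / (2 : ℝ) ^ N)) *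
      ∑ k ∈ s, w k * (((Finset.univ.filter fun x : Fin N → Bool => j ∈ (t k).queries x).card : ℝ) / (2 : ℝ) ^ N) := by
  classical
  set δ : Fin N → ℝ := fun j => ∑ k ∈ s, w k *
    (((Finset.univ.filter fun x : Fin N → Bool => j ∈ (t k).queries x).card : ℝ) / (2 : ℝ) ^ N) with hδ
  have hne : (Finset.univ : Finset (Fin N)).Nonempty := ⟨⟨0, hN⟩, Finset.mem_univ _⟩
  obtain ⟨j, -, hj⟩ := Finset.exists_max_image Finset.univ δ hne
  refine ⟨j, ?_⟩
  have h := four_boolVariance_le_mul_sum_queryProb s w hw t p hp fun i => hj i (Finset.mem_univ i)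
  change 4 * boolVariance p ≤ δ j * ∑ i, δ i at h
  change 4 * boolVariance p ≤ (∑ i, δ i) * δ j
  calc 4 * boolVariance p ≤ δ j * ∑ i, δ i := h
    _ = (∑ i, δ i) * δ j := mul_comm _ _

end ClassicalCornerQueryConcentration

end Summit.QuantumAdvantage.QuantumAdvantage.Theorems.SosSandwich

end
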